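import Summits.ValiantsHypothesis.ValiantsHypothesis.Theorems.LacunarySymmetroidMatrixDescartesCensusDoorA34NodeChambers

/-!
# `MatrixDescartes` census — DOOR A at `(3,4)`: NODE INTERLACING — the three eigenvalue branches of a four-real-node net are
# pinned between consecutive node nomials

HONEST FRAMING.  Object-search cell `pub-symmetroid`, door-A seat `val-sym-door-p3` (g9); item stmt-ValiantsHypothesis-19980
`DoorA34 = PosRootLawAt 3 4 18` (route item `Theses.LacunarySymmetroid.DoorA34`) is OPEN and asserted nowhere in this file.
Companion of `…CensusDoorA34NodeChambers` (chamber law: type = parity of the node sign vector).  For `M = ∑ᵢ ℓᵢ • vᵢvᵢᵀ`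
(four rank-one real symmetric `3 × 3` matrices — the value at any `t` of any pencil in a net with four real nodes) and the frame
Gram matrix `B = ∑ᵢ vᵢvᵢᵀ`:

* `sub_smul_frame` — `M − λ • B = ∑ᵢ (ℓᵢ − λ) • vᵢvᵢᵀ`; `det_sub_smul_frame` — by Cauchy–Binet (`…NodeForm.det_sum_four_rankOne`)
  `det (M − λ • B) = ∑ᵢ Cᵢ² ∏_{j≠i} (ℓⱼ − λ)`, a cubic in `λ` weighted by the four cofactor squares (secular form `∑ Cᵢ²/(ℓᵢ − λ) = 0`:
  for equal weights the `B`-eigenvalues of `M` are the critical points of the node quartic `∏ (λ − ℓᵢ)`);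
* `det_sub_smul_frame_at_node_three` — at a node value, `det (M − ℓ₃ • B) = C₃² (ℓ₀ − ℓ₃)(ℓ₁ − ℓ₃)(ℓ₂ − ℓ₃)` (relabel for the others);
* **`node_interlacing`** — if `ℓ₀ < ℓ₁ < ℓ₂ < ℓ₃` and the frame is in general position (all four cofactors `Cᵢ ≠ 0`), then
  `λ ↦ det (M − λ • B)` vanishes in each of `(ℓ₀,ℓ₁)`, `(ℓ₁,ℓ₂)`, `(ℓ₂,ℓ₃)`: the three `B`-eigenvalues of `M` — same inertia as `M`
  (`B ≻ 0`), zero exactly when `det M = 0` — INTERLACE the four node values strictly.  Along a node-frame pencil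
  `F(t) = ∑ᵢ ℓᵢ(t) • vᵢvᵢᵀ` the `k`-th eigenvalue branch is pinned between the `k`-th and `(k+1)`-st node nomials (sorted at each
  `t`); by Hellmann–Feynman its velocity is a convex combination of the node-nomial velocities (not formalised here).  In
  particular the middle branch can vanish only where the two middle node values straddle `0` — the `2–2` chambers of the
  chamber law, which is where every census seventeen of class R4 keeps all its roots (located, seat numerics).

Nothing here bounds `ζ_sym(3,4)`; `DoorA34` stays OPEN; nothing bears on `MatrixDescartes` (stmt-ValiantsHypothesis-18050) or
on `VP ≠ VNP`.  [folklore] Cauchy interlacing / the secular equation for rank-one updates (e.g. Blekherman–Parrilo–Thomas, *Semidefinite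
Optimization and Convex Algebraic Geometry* (2012), §9.5 p. 413; the four-nodal Cayley cubic bounding the elliptope, ibid. Ex. 5.44);
elementary (IVT on a cubic).
-/

-- `Summit.ValiantsHypothesis.ValiantsHypothesis.…` repeats a component by the D-0017 layout
-- (single-conjunct summit), which the `dupNamespace` linter flags; the name is mandated.
set_option linter.dupNamespace false

namespace Summit.ValiantsHypothesis.ValiantsHypothesis.Theorems.LacunarySymmetroidMatrixDescartes.Census

open Finset
open scoped BigOperators Matrix

/-! ## Node interlacing -/

/-- The characteristic polynomial of the pair `(M, B)`, `B = ∑ᵢ vᵢvᵢᵀ` the frame Gram matrix: `M − λ • B = ∑ᵢ (ℓᵢ − λ) • vᵢvᵢᵀ`. [folklore] -/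
theorem sub_smul_frame (v : Fin 4 → Fin 3 → ℝ) (ℓ : Fin 4 → ℝ) (lam : ℝ) :
    (∑ i, ℓ i • Matrix.vecMulVec (v i) (v i)) - lam • (∑ i, Matrix.vecMulVec (v i) (v i))
      = ∑ i, (ℓ i - lam) • Matrix.vecMulVec (v i) (v i) := by
  rw [Finset.smul_sum, ← Finset.sum_sub_distrib]
  exact Finset.sum_congr rfl fun i _ => (sub_smul _ _ _).symm

/-- **Value of the pair characteristic polynomial at a node value.**  At `λ = ℓ₃`:
`det (M − ℓ₃ • B) = C₃² (ℓ₀ − ℓ₃)(ℓ₁ − ℓ₃)(ℓ₂ − ℓ₃)` (and symmetrically at every `ℓⱼ` after relabelling). [folklore] -/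
theorem det_sub_smul_frame_at_node_three (v : Fin 4 → Fin 3 → ℝ) (ℓ : Fin 4 → ℝ) :
    ((∑ i, ℓ i • Matrix.vecMulVec (v i) (v i)) - ℓ 3 • (∑ i, Matrix.vecMulVec (v i) (v i))).det
      = (Matrix.of ![v 0, v 1, v 2]).det ^ 2 * ((ℓ 0 - ℓ 3) * (ℓ 1 - ℓ 3) * (ℓ 2 - ℓ 3)) := by
  rw [sub_smul_frame]
  exact det_eq_of_node_three_zero v (fun i => ℓ i - ℓ 3) (sub_self _)

/-- The pair characteristic polynomial written out (Cauchy–Binet): a cubic in `λ` with the four cofactor squares as weights. [folklore] -/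
theorem det_sub_smul_frame (v : Fin 4 → Fin 3 → ℝ) (ℓ : Fin 4 → ℝ) (lam : ℝ) :
    ((∑ i, ℓ i • Matrix.vecMulVec (v i) (v i)) - lam • (∑ i, Matrix.vecMulVec (v i) (v i))).det =
      (v 1 0 * (v 2 1 * v 3 2 - v 3 1 * v 2 2) - v 2 0 * (v 1 1 * v 3 2 - v 3 1 * v 1 2)
          + v 3 0 * (v 1 1 * v 2 2 - v 2 1 * v 1 2)) ^ 2 * ((ℓ 1 - lam) * (ℓ 2 - lam) * (ℓ 3 - lam))
      + (v 0 0 * (v 2 1 * v 3 2 - v 3 1 * v 2 2) - v 2 0 * (v 0 1 * v 3 2 - v 3 1 * v 0 2)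
          + v 3 0 * (v 0 1 * v 2 2 - v 2 1 * v 0 2)) ^ 2 * ((ℓ 0 - lam) * (ℓ 2 - lam) * (ℓ 3 - lam))
      + (v 0 0 * (v 1 1 * v 3 2 - v 3 1 * v 1 2) - v 1 0 * (v 0 1 * v 3 2 - v 3 1 * v 0 2)
          + v 3 0 * (v 0 1 * v 1 2 - v 1 1 * v 0 2)) ^ 2 * ((ℓ 0 - lam) * (ℓ 1 - lam) * (ℓ 3 - lam))
      + (v 0 0 * (v 1 1 * v 2 2 - v 2 1 * v 1 2) - v 1 0 * (v 0 1 * v 2 2 - v 2 1 * v 0 2)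
          + v 2 0 * (v 0 1 * v 1 2 - v 1 1 * v 0 2)) ^ 2 * ((ℓ 0 - lam) * (ℓ 1 - lam) * (ℓ 2 - lam)) := by
  rw [sub_smul_frame, det_sum_four_rankOne]

/-- **NODE INTERLACING.**  Let `M = ∑ᵢ ℓᵢ • vᵢvᵢᵀ` with node values `ℓ₀ < ℓ₁ < ℓ₂ < ℓ₃` and a frame in general position (all four
cofactors `Cᵢ ≠ 0`, i.e. every three of the `vᵢ` independent), and `B = ∑ᵢ vᵢvᵢᵀ` (positive definite).  Then the cubic
`λ ↦ det (M − λ • B)` has a zero in each of the open intervals `(ℓ₀,ℓ₁)`, `(ℓ₁,ℓ₂)`, `(ℓ₂,ℓ₃)`: the three `B`-eigenvalues of `M`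
— which have the inertia of `M` and vanish exactly when `det M = 0` — INTERLACE the four node values strictly.  (Secular form:
`∑ᵢ Cᵢ²/(ℓᵢ − λ) = 0`; the eigenvalues are the critical points of `∏ (λ − ℓᵢ)` for equal weights.)  Along a node-frame pencil
`F(t) = ∑ᵢ ℓᵢ(t) • vᵢvᵢᵀ` the `k`-th eigenvalue branch is pinned between the `k`-th and `(k+1)`-st node nomials in increasing
order at every `t`. [folklore] -/
theorem node_interlacing (v : Fin 4 → Fin 3 → ℝ) (ℓ : Fin 4 → ℝ) (h01 : ℓ 0 < ℓ 1) (h12 : ℓ 1 < ℓ 2) (h23 : ℓ 2 < ℓ 3)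
    (hC0 : v 1 0 * (v 2 1 * v 3 2 - v 3 1 * v 2 2) - v 2 0 * (v 1 1 * v 3 2 - v 3 1 * v 1 2)
          + v 3 0 * (v 1 1 * v 2 2 - v 2 1 * v 1 2) ≠ 0)
    (hC1 : v 0 0 * (v 2 1 * v 3 2 - v 3 1 * v 2 2) - v 2 0 * (v 0 1 * v 3 2 - v 3 1 * v 0 2)
          + v 3 0 * (v 0 1 * v 2 2 - v 2 1 * v 0 2) ≠ 0)
    (hC2 : v 0 0 * (v 1 1 * v 3 2 - v 3 1 * v 1 2) - v 1 0 * (v 0 1 * v 3 2 - v 3 1 * v 0 2)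
          + v 3 0 * (v 0 1 * v 1 2 - v 1 1 * v 0 2) ≠ 0)
    (hC3 : v 0 0 * (v 1 1 * v 2 2 - v 2 1 * v 1 2) - v 1 0 * (v 0 1 * v 2 2 - v 2 1 * v 0 2)
          + v 2 0 * (v 0 1 * v 1 2 - v 1 1 * v 0 2) ≠ 0) :
    (∃ lam ∈ Set.Ioo (ℓ 0) (ℓ 1),
        ((∑ i, ℓ i • Matrix.vecMulVec (v i) (v i)) - lam • (∑ i, Matrix.vecMulVec (v i) (v i))).det = 0) ∧
    (∃ lam ∈ Set.Ioo (ℓ 1) (ℓ 2),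
        ((∑ i, ℓ i • Matrix.vecMulVec (v i) (v i)) - lam • (∑ i, Matrix.vecMulVec (v i) (v i))).det = 0) ∧
    (∃ lam ∈ Set.Ioo (ℓ 2) (ℓ 3),
        ((∑ i, ℓ i • Matrix.vecMulVec (v i) (v i)) - lam • (∑ i, Matrix.vecMulVec (v i) (v i))).det = 0) := by
  -- abbreviate the cofactors and the characteristic function
  set C0 := v 1 0 * (v 2 1 * v 3 2 - v 3 1 * v 2 2) - v 2 0 * (v 1 1 * v 3 2 - v 3 1 * v 1 2)
          + v 3 0 * (v 1 1 * v 2 2 - v 2 1 * v 1 2) with hC0d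
  set C1 := v 0 0 * (v 2 1 * v 3 2 - v 3 1 * v 2 2) - v 2 0 * (v 0 1 * v 3 2 - v 3 1 * v 0 2)
          + v 3 0 * (v 0 1 * v 2 2 - v 2 1 * v 0 2) with hC1d
  set C2 := v 0 0 * (v 1 1 * v 3 2 - v 3 1 * v 1 2) - v 1 0 * (v 0 1 * v 3 2 - v 3 1 * v 0 2)
          + v 3 0 * (v 0 1 * v 1 2 - v 1 1 * v 0 2) with hC2d
  set C3 := v 0 0 * (v 1 1 * v 2 2 - v 2 1 * v 1 2) - v 1 0 * (v 0 1 * v 2 2 - v 2 1 * v 0 2)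
          + v 2 0 * (v 0 1 * v 1 2 - v 1 1 * v 0 2) with hC3d
  let f : ℝ → ℝ := fun lam =>
    C0 ^ 2 * ((ℓ 1 - lam) * (ℓ 2 - lam) * (ℓ 3 - lam)) + C1 ^ 2 * ((ℓ 0 - lam) * (ℓ 2 - lam) * (ℓ 3 - lam))
      + C2 ^ 2 * ((ℓ 0 - lam) * (ℓ 1 - lam) * (ℓ 3 - lam)) + C3 ^ 2 * ((ℓ 0 - lam) * (ℓ 1 - lam) * (ℓ 2 - lam))
  have hf : ∀ lam, ((∑ i, ℓ i • Matrix.vecMulVec (v i) (v i)) - lam • (∑ i, Matrix.vecMulVec (v i) (v i))).det = f lam :=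
    fun lam => det_sub_smul_frame v ℓ lam
  have hcont : Continuous f := by fun_prop
  have p0 : 0 < C0 ^ 2 := by positivity
  have p1 : 0 < C1 ^ 2 := by positivity
  have p2 : 0 < C2 ^ 2 := by positivity
  have p3 : 0 < C3 ^ 2 := by positivity
  -- signs at the four node values
  have f0 : 0 < f (ℓ 0) := by
    have : f (ℓ 0) = C0 ^ 2 * ((ℓ 1 - ℓ 0) * (ℓ 2 - ℓ 0) * (ℓ 3 - ℓ 0)) := by simp only [f, sub_self]; ring
    rw [this]
    exact mul_pos p0 (mul_pos (mul_pos (by linarith) (by linarith)) (by linarith))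
  have f1 : f (ℓ 1) < 0 := by
    have : f (ℓ 1) = -(C1 ^ 2 * ((ℓ 1 - ℓ 0) * (ℓ 2 - ℓ 1) * (ℓ 3 - ℓ 1))) := by simp only [f, sub_self]; ring
    rw [this]
    exact neg_neg_of_pos (mul_pos p1 (mul_pos (mul_pos (by linarith) (by linarith)) (by linarith)))
  have f2 : 0 < f (ℓ 2) := by
    have : f (ℓ 2) = C2 ^ 2 * ((ℓ 2 - ℓ 0) * (ℓ 2 - ℓ 1) * (ℓ 3 - ℓ 2)) := by simp only [f, sub_self]; ring
    rw [this]
    exact mul_pos p2 (mul_pos (mul_pos (by linarith) (by linarith)) (by linarith))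
  have f3 : f (ℓ 3) < 0 := by
    have : f (ℓ 3) = -(C3 ^ 2 * ((ℓ 3 - ℓ 0) * (ℓ 3 - ℓ 1) * (ℓ 3 - ℓ 2))) := by simp only [f, sub_self]; ring
    rw [this]
    exact neg_neg_of_pos (mul_pos p3 (mul_pos (mul_pos (by linarith) (by linarith)) (by linarith)))
  refine ⟨?_, ?_, ?_⟩
  · obtain ⟨lam, hlam, hval⟩ : ∃ lam ∈ Set.Ioo (ℓ 0) (ℓ 1), f lam = 0 :=
      intermediate_value_Ioo' h01.le hcont.continuousOn ⟨f1, f0⟩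
    exact ⟨lam, hlam, by rw [hf]; exact hval⟩
  · obtain ⟨lam, hlam, hval⟩ : ∃ lam ∈ Set.Ioo (ℓ 1) (ℓ 2), f lam = 0 :=
      intermediate_value_Ioo h12.le hcont.continuousOn ⟨f1, f2⟩
    exact ⟨lam, hlam, by rw [hf]; exact hval⟩
  · obtain ⟨lam, hlam, hval⟩ : ∃ lam ∈ Set.Ioo (ℓ 2) (ℓ 3), f lam = 0 :=
      intermediate_value_Ioo' h23.le hcont.continuousOn ⟨f3, f2⟩
    exact ⟨lam, hlam, by rw [hf]; exact hval⟩


end Summit.ValiantsHypothesis.ValiantsHypothesis.Theorems.LacunarySymmetroidMatrixDescartes.Census
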